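import Literature.Analysis.FluidPDE.NormalisedPressureLpBoundNearOne
import Literature.Analysis.FluidPDE.NormalisedPressureLpClass
import HarnessLib

/-!
# The near-`p = 1` pressure bound on the Lebesgue class: `‖p̃[w]‖_p ≤ C₀ (p−1)⁻¹ ‖|w|²‖_p`, `w ∈ L²ᵖ`

Analysis/FluidPDE proof file (theorems only; no definitions, no named facts); sibling of
`NormalisedPressureLpBoundNearOne`, which proves Stein 1970, Ch. II §6.2 (a) for the normalised
pressure on TEST fields: ONE constant `C₀` with `‖p̃[w]‖_{L^p} ≤ C₀ (p−1)⁻¹ ‖|w|²‖_{L^p}` for all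
`1 < p ≤ 2` and `w ∈ C^∞_c(ℝ³; ℝ³)` (`exists_eLpNorm_normalisedPressure_le_near_one`). This file
extends the SAME bound, with the SAME shape of the constant, to the natural Lebesgue class
`w ∈ L²ᵖ(ℝ³; ℝ³)` (equivalently `|w|² ∈ Lᵖ`), and records the continuous compactly supported
case, which is the form the `L log L → L¹_loc` estimate for `C²_c` fields consumes (`ns`
instrument «pressure budget with a logarithm», piece `NearFieldLog`, 2026-08-29).

## The argument (Stein 1970, Ch. II §2.2: "one can thus extend `T` to all of `L^p` by continuity")

Test fields are dense in `L²ᵖ` (`exists_smooth_seq_tendsto_eLpNorm_withDensity`, weight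
exponent `0`), `w ↦ p̃[w]` is continuous `L²ᵖ → Lᵖ` on the class
(`tendsto_eLpNorm_normalisedPressure_sub_of_tendsto_two_mul`, from the bilinear Calderón–Zygmund
estimate), and `‖|wₙ|²‖_p = ‖wₙ‖²_{2p} ≤ (‖wₙ − w‖_{2p} + ‖w‖_{2p})²`; so
`‖p̃[w]‖_p ≤ ‖p̃[w] − p̃[wₙ]‖_p + C₀(p−1)⁻¹(‖wₙ − w‖_{2p} + ‖w‖_{2p})² → C₀(p−1)⁻¹‖|w|²‖_p`.

## Contents

* `exists_eLpNorm_normalisedPressure_le_near_one_of_memLp` — the bound for `w ∈ L²ᵖ`;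
* `exists_eLpNorm_normalisedPressure_le_near_one_of_continuous` — for `w ∈ C_c(ℝ³; ℝ³)`;
* `exists_eLpNorm_normalisedPressure_le_near_one_of_contDiff_two` — for `w ∈ C²_c(ℝ³; ℝ³)`.

## References

* E. M. Stein, *Singular integrals and differentiability properties of functions*, Princeton
  Math. Series 30 (1970): Ch. II §6.2 (a) (`A_p ≤ A/(p−1)`, `1 < p ≤ 2`), §2.2 Theorem 1 (the
  extension by continuity), §4.2 Theorem 3 / §4.5 Theorem 4 (the class). [`Stein1971`]
* T.-P. Tsai, *On Leray's self-similar solutions of the Navier–Stokes equations satisfying local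
  energy estimates*, ARMA 143 (1998), proof of Lemma 2.1, p. 34 (the approximation step).
  [`Tsai1998`]
-/

noncomputable section

open MeasureTheory Set Filter Topology Function Metric
open scoped ENNReal NNReal RealInnerProductSpace ContDiff

namespace Literature.Analysis.FluidPDE

-- nested operator types in the imported pressure files
set_option maxSynthPendingDepth 3

/-- **The near-`p = 1` bound for the normalised pressure on the Lebesgue class** (Stein 1970,
Ch. II §6.2 (a) with the extension by continuity of §2.2): there is ONE constant `C₀` such that
for every `1 < p ≤ 2` and every `w ∈ L²ᵖ(ℝ³; ℝ³)`,
`‖p̃[w]‖_{L^p} ≤ C₀ (p − 1)⁻¹ ‖|w|²‖_{L^p}` (test fields `wₙ → w` in `L²ᵖ`, the bound for `wₙ`,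
`p̃[wₙ] → p̃[w]` in `Lᵖ`). [cite: Stein1971, Ch. II §6.2 (a)] -/
theorem exists_eLpNorm_normalisedPressure_le_near_one_of_memLp :
    ∃ C₀ : ℝ≥0, ∀ p : ℝ≥0∞, 1 < p → p ≤ 2 →
      ∀ w : EuclideanSpace ℝ (Fin 3) → EuclideanSpace ℝ (Fin 3), MemLp w (2 * p) volume →
        eLpNorm (normalisedPressure w) p volume ≤
          (C₀ : ℝ≥0∞) / (p - 1) * eLpNorm (fun x => ‖w x‖ ^ 2) p volume := by
  obtain ⟨C₀, hC₀⟩ := exists_eLpNorm_normalisedPressure_le_near_one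
  refine ⟨C₀, fun p hp1 hp2 w hw => ?_⟩
  have hp_top : p < ⊤ := lt_of_le_of_lt hp2 ENNReal.ofNat_lt_top
  have h12p : (1 : ℝ≥0∞) ≤ 2 * p :=
    calc (1 : ℝ≥0∞) = 1 * 1 := (one_mul 1).symm
      _ ≤ 2 * p := mul_le_mul' (by norm_num) hp1.le
  have h2pt : 2 * p ≠ ⊤ := ENNReal.mul_ne_top ENNReal.ofNat_ne_top hp_top.ne
  set K : ℝ≥0∞ := (C₀ : ℝ≥0∞) / (p - 1) with hK
  have hKt : K ≠ ⊤ := by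
    rw [hK]
    refine ENNReal.div_ne_top ENNReal.coe_ne_top ?_
    exact (tsub_pos_of_lt hp1).ne'
  -- test fields `v n → w` in `L²ᵖ`
  have h0 : (volume.withDensity fun x : (EuclideanSpace ℝ (Fin 3)) => ‖x‖ₑ ^ (0 : ℝ)) = volume := by
    simp only [ENNReal.rpow_zero]
    exact withDensity_one
  obtain ⟨v, hv, hvT⟩ := exists_smooth_seq_tendsto_eLpNorm_withDensity
    (G := (EuclideanSpace ℝ (Fin 3))) (p := 2 * p) (by norm_num : (-3 : ℝ) < 0) h12p h2pt (U := w)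
    (by rw [h0]; exact hw)
  rw [h0] at hvT
  have hvm : ∀ n, MemLp (v n) (2 * p) volume := fun n =>
    (hv n).1.continuous.memLp_of_hasCompactSupport (hv n).2
  -- `p̃[v n] → p̃[w]` in `Lᵖ`
  have hconvP : Tendsto (fun n => eLpNorm (normalisedPressure (v n) - normalisedPressure w) p volume)
      atTop (𝓝 0) := by
    have h := tendsto_eLpNorm_normalisedPressure_sub_of_tendsto_two_mul hp1 hp_top hvm hw
      (by simpa [Pi.sub_def] using hvT)
    exact h
  -- measurability
  have hPw : AEStronglyMeasurable (normalisedPressure w) volume :=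
    (memLp_normalisedPressure_of_memLp_two_mul hp1 hp_top hw).1
  have hPv : ∀ n, AEStronglyMeasurable (normalisedPressure (v n)) volume := fun n =>
    (memLp_normalisedPressure_of_memLp_two_mul hp1 hp_top (hvm n)).1
  -- the bound for each `n`
  have hbound : ∀ n, eLpNorm (normalisedPressure w) p volume ≤
      eLpNorm (normalisedPressure (v n) - normalisedPressure w) p volume +
        K * (eLpNorm (v n - w) (2 * p) volume + eLpNorm w (2 * p) volume) ^ 2 := by
    intro n
    -- `p̃[w] = (p̃[w] - p̃[vₙ]) + p̃[vₙ]`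
    have htri : eLpNorm (normalisedPressure w) p volume ≤
        eLpNorm (normalisedPressure w - normalisedPressure (v n)) p volume +
          eLpNorm (normalisedPressure (v n)) p volume := by
      have e : normalisedPressure w =
          (normalisedPressure w - normalisedPressure (v n)) + normalisedPressure (v n) :=
        (sub_add_cancel _ _).symm
      calc eLpNorm (normalisedPressure w) p volume
          = eLpNorm ((normalisedPressure w - normalisedPressure (v n)) + normalisedPressure (v n))
              p volume := by rw [← e]
        _ ≤ _ := eLpNorm_add_le (hPw.sub (hPv n)) (hPv n) hp1.le
    rw [eLpNorm_sub_comm] at htri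
    -- the bound on the test field
    have hvn : eLpNorm (normalisedPressure (v n)) p volume ≤
        K * (eLpNorm (v n - w) (2 * p) volume + eLpNorm w (2 * p) volume) ^ 2 := by
      refine (hC₀ p hp1 hp2 (v n) (hv n).1 (hv n).2).trans ?_
      rw [← hK, eLpNorm_norm_sq_eq_two_mul]
      gcongr
      -- `‖vₙ‖_{2p} ≤ ‖vₙ - w‖_{2p} + ‖w‖_{2p}`
      have e : v n = (v n - w) + w := (sub_add_cancel _ _).symm
      calc eLpNorm (v n) (2 * p) volume = eLpNorm ((v n - w) + w) (2 * p) volume := by rw [← e]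
        _ ≤ _ := eLpNorm_add_le ((hvm n).1.sub hw.1) hw.1 h12p
    exact htri.trans (add_le_add le_rfl hvn)
  -- the right-hand sides converge to `K ‖w‖²_{2p} = K ‖|w|²‖_p`
  have hlim : Tendsto (fun n => eLpNorm (normalisedPressure (v n) - normalisedPressure w) p volume +
      K * (eLpNorm (v n - w) (2 * p) volume + eLpNorm w (2 * p) volume) ^ 2) atTop
      (𝓝 (0 + K * (0 + eLpNorm w (2 * p) volume) ^ 2)) := by
    refine hconvP.add (ENNReal.Tendsto.const_mul ?_ (Or.inr hKt))
    exact ((ENNReal.continuous_pow 2).tendsto _).comp (hvT.add tendsto_const_nhds)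
  have h := ge_of_tendsto' hlim hbound
  rwa [zero_add, zero_add, ← eLpNorm_norm_sq_eq_two_mul] at h

/-- **The near-`p = 1` bound for the normalised pressure on `C_c(ℝ³; ℝ³)`** (the continuous
compactly supported case of the Lebesgue-class bound; the text consumed by the `ns` piece
`NearFieldLog` for `C²_c` fields): ONE constant `C₀` with
`‖p̃[w]‖_{L^p} ≤ C₀ (p − 1)⁻¹ ‖|w|²‖_{L^p}` for all `1 < p ≤ 2` and all continuous compactly
supported `w`. [cite: Stein1971, Ch. II §6.2 (a)] -/
theorem exists_eLpNorm_normalisedPressure_le_near_one_of_continuous :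
    ∃ C₀ : ℝ≥0, ∀ p : ℝ≥0∞, 1 < p → p ≤ 2 →
      ∀ w : EuclideanSpace ℝ (Fin 3) → EuclideanSpace ℝ (Fin 3), Continuous w → HasCompactSupport w →
        eLpNorm (normalisedPressure w) p volume ≤
          (C₀ : ℝ≥0∞) / (p - 1) * eLpNorm (fun x => ‖w x‖ ^ 2) p volume := by
  obtain ⟨C₀, hC₀⟩ := exists_eLpNorm_normalisedPressure_le_near_one_of_memLp
  exact ⟨C₀, fun p hp1 hp2 w hw hwc => hC₀ p hp1 hp2 w (hw.memLp_of_hasCompactSupport hwc)⟩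

/-- **The same for `C²_c` fields** (the hypothesis `hS` of the `ns` piece `NearFieldLog`, by name).
[cite: Stein1971, Ch. II §6.2 (a)] -/
theorem exists_eLpNorm_normalisedPressure_le_near_one_of_contDiff_two :
    ∃ C₀ : ℝ≥0, ∀ p : ℝ≥0∞, 1 < p → p ≤ 2 →
      ∀ w : EuclideanSpace ℝ (Fin 3) → EuclideanSpace ℝ (Fin 3), ContDiff ℝ 2 w → HasCompactSupport w →
        eLpNorm (normalisedPressure w) p volume ≤
          (C₀ : ℝ≥0∞) / (p - 1) * eLpNorm (fun x => ‖w x‖ ^ 2) p volume := by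
  obtain ⟨C₀, hC₀⟩ := exists_eLpNorm_normalisedPressure_le_near_one_of_continuous
  exact ⟨C₀, fun p hp1 hp2 w hw hwc => hC₀ p hp1 hp2 w hw.continuous hwc⟩

end Literature.Analysis.FluidPDE

end
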